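import Literature.MathematicalPhysics.KineticTheory.ShortRangePotentialsProofs
import Literature.MathematicalPhysics.KineticTheory.TaggedSphereDiffusiveOfApprox
import HarnessLib

/-!
# BGSR Theorem 2.2 with its rate (2.9) and the corrected Theorem 2.3 DISCHARGED
(Bodineau–Gallagher–Saint-Raymond, Invent. Math. 203 (2016) = arXiv:1305.3397v2, Thm 2.2 (2.9),
Thm 2.3, §6.1)

Topic `Literature/MathematicalPhysics/KineticTheory`; pure composition (no definition, no named
fact) joining two leaves of the tree with disjoint import closures:

* `bgsr_linearBoltzmannApprox_of_H1` (`TaggedSphereContactTrace`): BGSR's Theorem 2.2 in its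
  uniform form (2.9) — the named fact `bgsr_linearBoltzmannApprox` of `TaggedSphereDiffusion` —
  from the one-step integrated BBGKY hierarchy (H1) of the honest marginals of the transported
  datum (2.8) ALONE (the pruned Duhamel series of BGSR §§4–5, the contact-trace form (H1♯),
  `bgsr_linearBoltzmannApprox_of_oneStep`, `…_of_domainInputs`);
* `bgsr_oneStep_H1` (`ShortRangePotentialsProofs`): (H1) itself, PROVED (Cercignani–Illner–
  Pulvirenti 1994 Thm 4.3.1 along the chain `HardSphereMildBBGKY*`), with which the sibling fact
  (c) `bodineau_gallagher_saintRaymond_linear` was discharged there.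

Hence `bgsr_linearBoltzmannApprox_holds`, and — Lemma 6.1, `κ_β > 0` and the hydrodynamic limit
(6.3) being theorems of the tree (`bodineau_gallagher_saintRaymond_diffusive_of_linearBoltzmannApprox`,
`TaggedSphereDiffusiveOfApprox`) — the corrected one-time-marginal form of BGSR's Theorem 2.3,
the named fact `bodineau_gallagher_saintRaymond_diffusive` (`TaggedSphereDiffusion`, hilbert6.S22
(d) corrected), holds: `bodineau_gallagher_saintRaymond_diffusive_holds`.

## References

* T. Bodineau, I. Gallagher, L. Saint-Raymond, *The Brownian motion as the limit of a
  deterministic system of hard-spheres*, Invent. Math. 203 (2016) 493–553 = arXiv:1305.3397v2,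
  Thm 2.2 (2.9) p. 7, Thm 2.3 (2.11)–(2.12) p. 8, §6.1 (6.1)–(6.3).
  [BodineauGallagherSaintRaymondInvent2016]
* C. Cercignani, R. Illner, M. Pulvirenti, *The Mathematical Theory of Dilute Gases* (1994),
  §4.3 Thm 4.3.1. [CIP1994]
-/

namespace Literature.MathematicalPhysics.KineticTheory

variable {d : Type*} [Fintype d]

/-- **BGSR Theorem 2.2 with the rate (2.9) (`bgsr_linearBoltzmannApprox`) holds**: the reduction
to the one-step mild BBGKY hierarchy `bgsr_linearBoltzmannApprox_of_H1` fed with the proved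
hierarchy `bgsr_oneStep_H1`. [cite: BodineauGallagherSaintRaymondInvent2016, Thm 2.2 (2.9), p. 7] -/
theorem bgsr_linearBoltzmannApprox_holds : bgsr_linearBoltzmannApprox (d := d) := by
  classical
  exact bgsr_linearBoltzmannApprox_of_H1 bgsr_oneStep_H1

/-- **BGSR Theorem 2.3 (Brownian limit of a tagged hard sphere; one-time position marginals,
corrected growth hypothesis) holds**: the named fact `bodineau_gallagher_saintRaymond_diffusive`,
by `bodineau_gallagher_saintRaymond_diffusive_of_linearBoltzmannApprox` (Thm 2.3 = (6.1) + (6.3),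
the latter discharged in the tree) and `bgsr_linearBoltzmannApprox_holds`.
[cite: BodineauGallagherSaintRaymondInvent2016, Thm. 2.3 with Thm. 2.2, §6.1.1 (6.1) and (6.3)] -/
theorem bodineau_gallagher_saintRaymond_diffusive_holds :
    bodineau_gallagher_saintRaymond_diffusive (d := d) := by
  classical
  exact bodineau_gallagher_saintRaymond_diffusive_of_linearBoltzmannApprox bgsr_linearBoltzmannApprox_holds

end Literature.MathematicalPhysics.KineticTheory
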